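import Summits.KontsevichZagierPeriods.KontsevichZagierPeriods.Theorems.RootDecompZetaThreeFrontierThreeLayerP4

/-! # `RootDecompZetaThreeFrontierThreeLayerP5` — part 5/7 of the mechanical ≤340-line split of decomp-kz lens-1 g12 `ThreeLayer_v1.lean`
(sha256 4ebbf5d0…: §18 the diagonal-straightening move Σ / un-bending τ_v and their relations, §47 the layer ⟹ words algorithm;
`…GZLadder.stub_three_layer` of «gz_ladder» v4 on stmt-KontsevichZagierPeriods-32433 is proved in part 7).  Mathematics unchanged; part 5 continues part 4. -/

set_option linter.dupNamespace false

noncomputable section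

/-! ## §47b  (gen 12) `gz_ladder.stub_three_layer`: EVERY LAYER DATUM OF DIMENSION 3 IS CONGRUENT INTO `words 3 ∪ gzLETwo`.
The algorithm (RUNG3.md §3, typed): expand the numerator into monomials (rule 1b); a monomial class
`q t₀^i t₁^j t₂^k/(t₀^β₀ t₁^β₁ (1-t₁)^γ₁ (1-t₂)^γ₂ (t₀-t₂)^α)` with the layer bounds is reduced by
cancellation / partial fractions / the diagonal identities `t₀ = (t₀-t₂) + t₂` to (i) the three Newton–Leibniz ENGINES
(`ibpT2`, `ibpT1`, and `ibpT2` conjugated by the duality `σ₃`), (ii) the two WORDS `1/(t₀t₁(1-t₂))`, `1/(t₀(1-t₁)(1-t₂))`,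
(iii) the two DIAGONAL NORMAL FORMS `E_n = t₂ⁿ/(t₁(t₀-t₂))` and `H = 1/(t₁(1-t₂)(t₀-t₂))`, which the straightening chain
(§18/§47a) carries to engine classes resp. words.  Termination: the potentials `i+j+k+β₀+β₁+γ₁` (`α = 0`) and
`(γ₁, 2(i+j+β₀+β₁)+k)` (`α = 1`). -/


namespace Summit.KontsevichZagierPeriods.KontsevichZagierPeriods.Cruxes.GZNormalFormWThree.GZLadder

open Set MeasureTheory Literature.NumberTheory.Transcendental
open Summit.KontsevichZagierPeriods.RootDecompZetaThreeFrontier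
open Summit.KontsevichZagierPeriods.KontsevichZagierPeriods.Theorems.RootDecompZetaThreeFrontierWordMoves (ibpQ1 ibpB1 ibpT1
  dualRep3 dualRep3_integrand mem_simplex_three_duΦ)

section ThreeLayer

/-! ### 47b.1  engines and words, targeted at `words 3 ∪ gzLETwo` -/

/-- the t₂-engine into `words 3 ∪ gzLETwo` (the witness is the genus-zero boundary datum of dimension 2) -/
theorem wT2 (P : MvPolynomial (Fin 3) ℚ) (β₀ β₁ γ₁ γ₂ α : ℕ) (r : KZ.IntegralRep 3) (hd : r.domain = KZ.openOrderedSimplex 3)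
    (hi : EqOn r.integrand (WordLayer.layerF (WordLayer.ibpQ P γ₂ α) β₀ β₁ γ₁ (γ₂ + 1) (α + 1)) r.domain) :
    CongInto (words 3 ∪ gzLETwo) (KZ.of r) := by
  obtain ⟨r', hd', hi', hrel⟩ := WordLayer.ibpT2 P β₀ β₁ γ₁ γ₂ α r hd hi
  refine ⟨KZ.of r', AddSubgroup.subset_closure (Or.inr ⟨2, r', le_rfl, ⟨hd', WordLayer.ibpB P γ₂ α, fun _ _ => α, ![β₀ + α, β₁],
    ![0, γ₁ + γ₂], fun y hy => ?_⟩, rfl⟩), hrel⟩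
  rw [hi' hy]
  simp [Fin.prod_univ_two]

/-- the t₁-engine into `words 3 ∪ gzLETwo` -/
theorem wT1 (P : MvPolynomial (Fin 3) ℚ) (β₀ β₁ γ₁ γ₂ α : ℕ) (r : KZ.IntegralRep 3) (hd : r.domain = KZ.openOrderedSimplex 3)
    (hi : EqOn r.integrand (WordLayer.layerF (ibpQ1 P β₁ γ₁) β₀ (β₁ + 1) (γ₁ + 1) γ₂ α) r.domain) :
    CongInto (words 3 ∪ gzLETwo) (KZ.of r) := by
  obtain ⟨r', hd', hi', hrel⟩ := ibpT1 P β₀ β₁ γ₁ γ₂ α r hd hi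
  refine ⟨KZ.of r', AddSubgroup.subset_closure (Or.inr ⟨2, r', le_rfl, ⟨hd', ibpB1 P β₁ γ₁, fun _ _ => α, ![β₀ + β₁, β₁],
    ![γ₁, γ₁ + γ₂], fun y hy => ?_⟩, rfl⟩), hrel⟩
  rw [hi' hy]
  simp [Fin.prod_univ_two, mul_assoc]

/-- a datum on `Δ₃` whose integrand IS a word integrand is (trivially) congruent into `words 3` -/
theorem congT_word (ε : Fin 3 → Bool) (q : ℚ) (s : KZ.IntegralRep 3) (hd : s.domain = KZ.openOrderedSimplex 3)
    (hi : EqOn s.integrand (fun t => (q : ℝ) * ∏ i, if ε i then 1 / (1 - t i) else 1 / t i) s.domain) :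
    CongInto (words 3 ∪ gzLETwo) (KZ.of s) :=
  ⟨KZ.of s, AddSubgroup.subset_closure (Or.inl ⟨3, ε, q, s, le_rfl, hd, hi, rfl⟩), by
    rw [sub_self]; exact KZ.relations.zero_mem⟩

/-- two congruences and a three-term relation give a congruence -/
theorem congInto_of_rel2 {S : Set KZ.FormalRep} {x a b : KZ.FormalRep} (h : x - a - b ∈ KZ.relations)
    (ha : CongInto S a) (hb : CongInto S b) : CongInto S x := by
  obtain ⟨ma, hma, ha⟩ := ha
  obtain ⟨mb, hmb, hb⟩ := hb
  refine ⟨ma + mb, add_mem hma hmb, ?_⟩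
  have e : x - (ma + mb) = (x - a - b) + (a - ma) + (b - mb) := by abel
  rw [e]
  exact add_mem (add_mem h ha) hb

/-! ### 47b.2  monomial numerators and the polynomial identities feeding the engines -/

/-- Auxiliary step `pd2_X0` (§47b): pd2 X0. [bookkeeping] -/
theorem pd2_X0 : MvPolynomial.pderiv 2 (MvPolynomial.X 0 : MvPolynomial (Fin 3) ℚ) = 0 :=
  MvPolynomial.pderiv_X_of_ne (by decide)
/-- Auxiliary step `pd2_X1` (§47b): pd2 X1. [bookkeeping] -/
theorem pd2_X1 : MvPolynomial.pderiv 2 (MvPolynomial.X 1 : MvPolynomial (Fin 3) ℚ) = 0 :=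
  MvPolynomial.pderiv_X_of_ne (by decide)
/-- Auxiliary step `pd2_X2` (§47b): pd2 X2. [bookkeeping] -/
theorem pd2_X2 : MvPolynomial.pderiv 2 (MvPolynomial.X 2 : MvPolynomial (Fin 3) ℚ) = 1 :=
  MvPolynomial.pderiv_X_self 2
/-- Auxiliary step `pd1_X0` (§47b): pd1 X0. [bookkeeping] -/
theorem pd1_X0 : MvPolynomial.pderiv 1 (MvPolynomial.X 0 : MvPolynomial (Fin 3) ℚ) = 0 :=
  MvPolynomial.pderiv_X_of_ne (by decide)
/-- Auxiliary step `pd1_X1` (§47b): pd1 X1. [bookkeeping] -/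
theorem pd1_X1 : MvPolynomial.pderiv 1 (MvPolynomial.X 1 : MvPolynomial (Fin 3) ℚ) = 1 :=
  MvPolynomial.pderiv_X_self 1
/-- Auxiliary step `pd1_X2` (§47b): pd1 X2. [bookkeeping] -/
theorem pd1_X2 : MvPolynomial.pderiv 1 (MvPolynomial.X 2 : MvPolynomial (Fin 3) ℚ) = 0 :=
  MvPolynomial.pderiv_X_of_ne (by decide)

/-- the scaled monomial `q·X₀^i X₁^j X₂^k` -/
noncomputable def monoP (q : ℚ) (i j k : ℕ) : MvPolynomial (Fin 3) ℚ :=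
  MvPolynomial.C q * (MvPolynomial.X 0 ^ i * MvPolynomial.X 1 ^ j * MvPolynomial.X 2 ^ k)

/-- the scaled dual monomial `q·(1-X₂)^i (1-X₁)^j (1-X₀)^k` -/
noncomputable def dmonoP (q : ℚ) (i j k : ℕ) : MvPolynomial (Fin 3) ℚ :=
  MvPolynomial.C q * ((MvPolynomial.C 1 - MvPolynomial.X 2) ^ i * (MvPolynomial.C 1 - MvPolynomial.X 1) ^ j *
    (MvPolynomial.C 1 - MvPolynomial.X 0) ^ k)

/-- `q·(1-X₁)^j (1-X₀)^k X₂` (the primitive of the dual `β₀ = 2` terminal) -/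
noncomputable def PT0b (q : ℚ) (j k : ℕ) : MvPolynomial (Fin 3) ℚ :=
  MvPolynomial.C q * ((MvPolynomial.C 1 - MvPolynomial.X 1) ^ j * (MvPolynomial.C 1 - MvPolynomial.X 0) ^ k * MvPolynomial.X 2)

/-- Auxiliary step `aeval_monoP` (§47b): aeval mono P. [bookkeeping] -/
theorem aeval_monoP (q : ℚ) (i j k : ℕ) (t : Fin 3 → ℝ) :
    MvPolynomial.aeval t (monoP q i j k) = (q : ℝ) * (t 0 ^ i * t 1 ^ j * t 2 ^ k) := by
  simp only [monoP, map_mul, map_pow, MvPolynomial.aeval_C, MvPolynomial.aeval_X, eq_ratCast]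

/-- Auxiliary step `aeval_dmonoP` (§47b): aeval dmono P. [bookkeeping] -/
theorem aeval_dmonoP (q : ℚ) (i j k : ℕ) (t : Fin 3 → ℝ) :
    MvPolynomial.aeval t (dmonoP q i j k) = (q : ℝ) * ((1 - t 2) ^ i * (1 - t 1) ^ j * (1 - t 0) ^ k) := by
  simp only [dmonoP, map_mul, map_pow, map_sub, map_one, MvPolynomial.aeval_C, MvPolynomial.aeval_X, eq_ratCast]

/-- Auxiliary step `aeval_PT0b` (§47b): aeval PT0b. [bookkeeping] -/
theorem aeval_PT0b (q : ℚ) (j k : ℕ) (t : Fin 3 → ℝ) :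
    MvPolynomial.aeval t (PT0b q j k) = (q : ℝ) * ((1 - t 1) ^ j * (1 - t 0) ^ k * t 2) := by
  simp only [PT0b, map_mul, map_pow, map_sub, map_one, MvPolynomial.aeval_C, MvPolynomial.aeval_X, eq_ratCast]

/-- Auxiliary step `aeval_duP3_monoP` (§47b): aeval du P3 mono P. [bookkeeping] -/
theorem aeval_duP3_monoP (q : ℚ) (i j k : ℕ) (t : Fin 3 → ℝ) :
    MvPolynomial.aeval t (WordLayer.duP3 (monoP q i j k)) = (q : ℝ) * ((1 - t 2) ^ i * (1 - t 1) ^ j * (1 - t 0) ^ k) := by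
  rw [WordLayer.aeval_duP3, aeval_monoP, WordLayer.duΦ_zero, WordLayer.duΦ_one, WordLayer.duΦ_two]

/-- Auxiliary step `aeval_pd2_monoP` (§47b): aeval pd2 mono P. [bookkeeping] -/
theorem aeval_pd2_monoP (q : ℚ) (i j k : ℕ) (t : Fin 3 → ℝ) :
    MvPolynomial.aeval t (MvPolynomial.pderiv 2 (monoP q i j k)) = (q : ℝ) * (t 0 ^ i * t 1 ^ j * ((k : ℝ) * t 2 ^ (k - 1))) := by
  simp only [monoP, MvPolynomial.pderiv_mul, MvPolynomial.pderiv_pow, MvPolynomial.pderiv_C,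
    pd2_X0, pd2_X1, pd2_X2]
  simp only [mul_zero, zero_mul, add_zero, zero_add, mul_one, map_mul, map_pow, map_natCast,
    MvPolynomial.aeval_C, MvPolynomial.aeval_X, eq_ratCast]

/-- Auxiliary step `aeval_pd1_monoP` (§47b): aeval pd1 mono P. [bookkeeping] -/
theorem aeval_pd1_monoP (q : ℚ) (i j k : ℕ) (t : Fin 3 → ℝ) :
    MvPolynomial.aeval t (MvPolynomial.pderiv 1 (monoP q i j k)) = (q : ℝ) * (t 0 ^ i * ((j : ℝ) * t 1 ^ (j - 1)) * t 2 ^ k) := by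
  simp only [monoP, MvPolynomial.pderiv_mul, MvPolynomial.pderiv_pow, MvPolynomial.pderiv_C,
    pd1_X0, pd1_X1, pd1_X2]
  simp only [mul_zero, zero_mul, add_zero, zero_add, mul_one, map_mul, map_pow, map_natCast,
    MvPolynomial.aeval_C, MvPolynomial.aeval_X, eq_ratCast]

/-- Auxiliary step `aeval_pd2_dmonoP` (§47b): aeval pd2 dmono P. [bookkeeping] -/
theorem aeval_pd2_dmonoP (q : ℚ) (i j k : ℕ) (t : Fin 3 → ℝ) :
    MvPolynomial.aeval t (MvPolynomial.pderiv 2 (dmonoP q i j k)) =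
      (q : ℝ) * (-((i : ℝ) * (1 - t 2) ^ (i - 1)) * (1 - t 1) ^ j * (1 - t 0) ^ k) := by
  simp only [dmonoP, MvPolynomial.pderiv_mul, MvPolynomial.pderiv_pow, map_sub,
    MvPolynomial.pderiv_C, pd2_X0, pd2_X1, pd2_X2]
  simp only [mul_zero, zero_mul, add_zero, zero_add, sub_self, map_mul, map_pow, map_sub,
    map_natCast, map_zero, map_one, MvPolynomial.aeval_C, MvPolynomial.aeval_X, eq_ratCast]
  ring

/-- Auxiliary step `aeval_pd2_PT0b` (§47b): aeval pd2 PT0b. [bookkeeping] -/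
theorem aeval_pd2_PT0b (q : ℚ) (j k : ℕ) (t : Fin 3 → ℝ) :
    MvPolynomial.aeval t (MvPolynomial.pderiv 2 (PT0b q j k)) = (q : ℝ) * ((1 - t 1) ^ j * (1 - t 0) ^ k) := by
  simp only [PT0b, MvPolynomial.pderiv_mul, MvPolynomial.pderiv_pow, map_sub,
    MvPolynomial.pderiv_C, pd2_X0, pd2_X1, pd2_X2]
  simp only [mul_zero, zero_mul, add_zero, zero_add, mul_one, sub_self, map_mul, map_pow, map_sub,
    map_one, MvPolynomial.aeval_C, MvPolynomial.aeval_X, eq_ratCast]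

/-- Auxiliary step `aeval_pd2_PE1` (§47b): aeval pd2 PE1. [bookkeeping] -/
theorem aeval_pd2_PE1 (c : ℚ) (n : ℕ) (t : Fin 3 → ℝ) :
    MvPolynomial.aeval t (MvPolynomial.pderiv 2 (MvPolynomial.C c * (MvPolynomial.X 1 - MvPolynomial.X 2) ^ (n + 1))) =
      -((c : ℝ) * ((n : ℝ) + 1) * (t 1 - t 2) ^ n) := by
  simp only [MvPolynomial.pderiv_C_mul, MvPolynomial.pderiv_pow, map_sub, pd2_X1, pd2_X2]
  simp only [mul_one, zero_sub, mul_neg, map_mul, map_pow, map_sub, map_neg, map_add, map_natCast, map_one,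
    MvPolynomial.aeval_C, MvPolynomial.aeval_X, eq_ratCast, Nat.cast_add, Nat.cast_one, add_tsub_cancel_right]
  ring

/-- Auxiliary step `aeval_pd2_PE0` (§47b): aeval pd2 PE0. [bookkeeping] -/
theorem aeval_pd2_PE0 (c : ℚ) (n : ℕ) (t : Fin 3 → ℝ) :
    MvPolynomial.aeval t (MvPolynomial.pderiv 2 (MvPolynomial.C c * (MvPolynomial.X 0 - MvPolynomial.X 2) ^ (n + 1))) =
      -((c : ℝ) * ((n : ℝ) + 1) * (t 0 - t 2) ^ n) := by
  simp only [MvPolynomial.pderiv_C_mul, MvPolynomial.pderiv_pow, map_sub, pd2_X0, pd2_X2]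
  simp only [mul_one, zero_sub, mul_neg, map_mul, map_pow, map_sub, map_neg, map_add, map_natCast, map_one,
    MvPolynomial.aeval_C, MvPolynomial.aeval_X, eq_ratCast, Nat.cast_add, Nat.cast_one, add_tsub_cancel_right]
  ring

/-- Auxiliary step `aeval_PE1` (§47b): aeval PE1. [bookkeeping] -/
theorem aeval_PE1 (c : ℚ) (n : ℕ) (t : Fin 3 → ℝ) :
    MvPolynomial.aeval t (MvPolynomial.C c * (MvPolynomial.X 1 - MvPolynomial.X 2) ^ (n + 1)) = (c : ℝ) * (t 1 - t 2) ^ (n + 1) := by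
  simp only [map_mul, map_pow, map_sub, MvPolynomial.aeval_C, MvPolynomial.aeval_X, eq_ratCast]

/-- Auxiliary step `aeval_PE0` (§47b): aeval PE0. [bookkeeping] -/
theorem aeval_PE0 (c : ℚ) (n : ℕ) (t : Fin 3 → ℝ) :
    MvPolynomial.aeval t (MvPolynomial.C c * (MvPolynomial.X 0 - MvPolynomial.X 2) ^ (n + 1)) = (c : ℝ) * (t 0 - t 2) ^ (n + 1) := by
  simp only [map_mul, map_pow, map_sub, MvPolynomial.aeval_C, MvPolynomial.aeval_X, eq_ratCast]

/-- Auxiliary step `aeval_ibpQ` (§47b): aeval ibp Q. [bookkeeping] -/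
theorem aeval_ibpQ (P : MvPolynomial (Fin 3) ℚ) (g a : ℕ) (t : Fin 3 → ℝ) :
    MvPolynomial.aeval t (WordLayer.ibpQ P g a) =
      MvPolynomial.aeval t (MvPolynomial.pderiv 2 P) * ((1 - t 2) * (t 0 - t 2)) +
        MvPolynomial.aeval t P * ((g : ℝ) * (t 0 - t 2) + (a : ℝ) * (1 - t 2)) := by
  simp only [WordLayer.ibpQ, map_add, map_mul, map_sub, map_one, MvPolynomial.aeval_X, map_natCast]

/-- Auxiliary step `aeval_ibpQ1` (§47b): aeval ibp Q1. [bookkeeping] -/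
theorem aeval_ibpQ1 (P : MvPolynomial (Fin 3) ℚ) (b c : ℕ) (t : Fin 3 → ℝ) :
    MvPolynomial.aeval t (ibpQ1 P b c) =
      MvPolynomial.aeval t (MvPolynomial.pderiv 1 P) * (t 1 * (1 - t 1)) +
        MvPolynomial.aeval t P * ((c : ℝ) * t 1 - (b : ℝ) * (1 - t 1)) := by
  simp only [ibpQ1, map_add, map_mul, map_sub, map_one, MvPolynomial.aeval_X, map_natCast]

/-- t₂-engine identity (`γ₂ = 0`, `α = 0`; primitive `q t^{m+e₂}/(k+1)`) -/
theorem idT2a (q : ℚ) (i j k β₀ β₁ γ₁ : ℕ) {t : Fin 3 → ℝ} (ht : t ∈ KZ.openOrderedSimplex 3) :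
    WordLayer.layerF (monoP q i j k) β₀ β₁ γ₁ 0 0 t =
      WordLayer.layerF (WordLayer.ibpQ (monoP (q / (k + 1)) i j (k + 1)) 0 0) β₀ β₁ γ₁ (0 + 1) (0 + 1) t := by
  obtain ⟨h0, h1, h1', h2', hd⟩ := WordLayer.simplex3_facts ht
  have hk : (k : ℝ) + 1 ≠ 0 := by positivity
  simp only [WordLayer.layerF, aeval_ibpQ, aeval_pd2_monoP, aeval_monoP, Rat.cast_div, Rat.cast_add, Rat.cast_natCast,
    Rat.cast_one, Nat.cast_add, Nat.cast_one, Nat.cast_zero, add_tsub_cancel_right]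
  field_simp
  ring

/-- t₂-engine identity (`γ₂ = 2`, `k = 0`, `α = 0`; primitive `q t^m X₂`) -/
theorem idT2b (q : ℚ) (i j β₀ β₁ γ₁ : ℕ) {t : Fin 3 → ℝ} (ht : t ∈ KZ.openOrderedSimplex 3) :
    WordLayer.layerF (monoP q i j 0) β₀ β₁ γ₁ 2 0 t =
      WordLayer.layerF (WordLayer.ibpQ (monoP q i j 1) 1 0) β₀ β₁ γ₁ (1 + 1) (0 + 1) t := by
  obtain ⟨h0, h1, h1', h2', hd⟩ := WordLayer.simplex3_facts ht
  simp only [WordLayer.layerF, aeval_ibpQ, aeval_pd2_monoP, aeval_monoP, Nat.cast_one, Nat.cast_zero, Nat.sub_self]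
  field_simp
  ring

/-- t₁-engine identity (`β₁ = γ₁ = 0`; primitive `q t^{m+e₁}/(j+1)`) -/
theorem idT1 (q : ℚ) (i j k β₀ γ₂ α : ℕ) {t : Fin 3 → ℝ} (ht : t ∈ KZ.openOrderedSimplex 3) :
    WordLayer.layerF (monoP q i j k) β₀ 0 0 γ₂ α t =
      WordLayer.layerF (ibpQ1 (monoP (q / (j + 1)) i (j + 1) k) 0 0) β₀ (0 + 1) (0 + 1) γ₂ α t := by
  obtain ⟨h0, h1, h1', h2', hd⟩ := WordLayer.simplex3_facts ht
  have hj : (j : ℝ) + 1 ≠ 0 := by positivity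
  simp only [WordLayer.layerF, aeval_ibpQ1, aeval_pd1_monoP, aeval_monoP, Rat.cast_div, Rat.cast_add, Rat.cast_natCast,
    Rat.cast_one, Nat.cast_add, Nat.cast_one, Nat.cast_zero, add_tsub_cancel_right]
  field_simp
  ring

/-- t₀-engine identity on the dual side (`β₀ = 0`, `α = 0`) -/
theorem idT0a (q : ℚ) (i j k β₁ γ₁ γ₂ : ℕ) {t : Fin 3 → ℝ} (ht : t ∈ KZ.openOrderedSimplex 3) :
    WordLayer.layerF (WordLayer.duP3 (monoP q i j k)) γ₂ γ₁ β₁ 0 0 t =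
      WordLayer.layerF (WordLayer.ibpQ (dmonoP (-(q / (i + 1))) (i + 1) j k) 0 0) γ₂ γ₁ β₁ (0 + 1) (0 + 1) t := by
  obtain ⟨h0, h1, h1', h2', hd⟩ := WordLayer.simplex3_facts ht
  have hi : (i : ℝ) + 1 ≠ 0 := by positivity
  simp only [WordLayer.layerF, aeval_ibpQ, aeval_pd2_dmonoP, aeval_dmonoP, aeval_duP3_monoP, Rat.cast_div, Rat.cast_add,
    Rat.cast_natCast, Rat.cast_one, Rat.cast_neg, Nat.cast_add, Nat.cast_one, Nat.cast_zero, add_tsub_cancel_right]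
  field_simp
  ring

/-- t₀-engine identity on the dual side (`β₀ = 2`, `i = 0`, `α = 0`) -/
theorem idT0b (q : ℚ) (j k β₁ γ₁ γ₂ : ℕ) {t : Fin 3 → ℝ} (ht : t ∈ KZ.openOrderedSimplex 3) :
    WordLayer.layerF (WordLayer.duP3 (monoP q 0 j k)) γ₂ γ₁ β₁ 2 0 t =
      WordLayer.layerF (WordLayer.ibpQ (PT0b q j k) 1 0) γ₂ γ₁ β₁ (1 + 1) (0 + 1) t := by
  obtain ⟨h0, h1, h1', h2', hd⟩ := WordLayer.simplex3_facts ht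
  simp only [WordLayer.layerF, aeval_ibpQ, aeval_pd2_PT0b, aeval_PT0b, aeval_duP3_monoP, Nat.cast_one, Nat.cast_zero,
    pow_zero, one_mul]
  field_simp
  ring

/-- piece-A identity of the `E_n` terminal -/
theorem idEA (q : ℚ) (n : ℕ) {t : Fin 3 → ℝ} (ht : t ∈ KZ.openOrderedSimplex 3) :
    (q : ℝ) * (t 1 - t 2) ^ n * (1 - t 1) / ((1 - t 2) ^ (n + 2) * t 0 * t 1) =
      WordLayer.layerF (WordLayer.ibpQ (MvPolynomial.C (-(q / (n + 1))) * (MvPolynomial.X 1 - MvPolynomial.X 2) ^ (n + 1))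
        (n + 1) 0) 1 1 0 (n + 1 + 1) (0 + 1) t := by
  obtain ⟨h0, h1, h1', h2', hd⟩ := WordLayer.simplex3_facts ht
  have hn : (n : ℝ) + 1 ≠ 0 := by positivity
  simp only [WordLayer.layerF, aeval_ibpQ, aeval_pd2_PE1, aeval_PE1, Rat.cast_div, Rat.cast_add, Rat.cast_natCast,
    Rat.cast_one, Rat.cast_neg, Nat.cast_add, Nat.cast_one, Nat.cast_zero]
  field_simp
  ring

/-- piece-B identity of the `E_n` terminal -/
theorem idEB (q : ℚ) (n : ℕ) {t : Fin 3 → ℝ} (ht : t ∈ KZ.openOrderedSimplex 3) :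
    (q : ℝ) * (t 0 - t 2) ^ n * (1 - t 0) / ((1 - t 2) ^ (n + 2) * t 1 * t 0) =
      WordLayer.layerF (WordLayer.ibpQ (MvPolynomial.C (-(q / (n + 1))) * (MvPolynomial.X 0 - MvPolynomial.X 2) ^ (n + 1))
        (n + 1) 0) 1 1 0 (n + 1 + 1) (0 + 1) t := by
  obtain ⟨h0, h1, h1', h2', hd⟩ := WordLayer.simplex3_facts ht
  have hn : (n : ℝ) + 1 ≠ 0 := by positivity
  simp only [WordLayer.layerF, aeval_ibpQ, aeval_pd2_PE0, aeval_PE0, Rat.cast_div, Rat.cast_add, Rat.cast_natCast,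
    Rat.cast_one, Rat.cast_neg, Nat.cast_add, Nat.cast_one, Nat.cast_zero]
  field_simp
  ring

/-! ### 47b.3  the pointwise reduction identities (cancellation, partial fractions, diagonal) -/

/-- Auxiliary step `idCancel0` (§47b): id Cancel0. [bookkeeping] -/
theorem idCancel0 (q : ℚ) (i j k β₀ β₁ γ₁ γ₂ α : ℕ) {t : Fin 3 → ℝ} (ht : t ∈ KZ.openOrderedSimplex 3) :
    WordLayer.layerF (monoP q (i + 1) j k) (β₀ + 1) β₁ γ₁ γ₂ α t = WordLayer.layerF (monoP q i j k) β₀ β₁ γ₁ γ₂ α t := by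
  obtain ⟨h0, h1, h1', h2', hd⟩ := WordLayer.simplex3_facts ht
  simp only [WordLayer.layerF, aeval_monoP, pow_succ]
  field_simp

/-- Auxiliary step `idCancel1` (§47b): id Cancel1. [bookkeeping] -/
theorem idCancel1 (q : ℚ) (i j k β₀ β₁ γ₁ γ₂ α : ℕ) {t : Fin 3 → ℝ} (ht : t ∈ KZ.openOrderedSimplex 3) :
    WordLayer.layerF (monoP q i (j + 1) k) β₀ (β₁ + 1) γ₁ γ₂ α t = WordLayer.layerF (monoP q i j k) β₀ β₁ γ₁ γ₂ α t := by
  obtain ⟨h0, h1, h1', h2', hd⟩ := WordLayer.simplex3_facts ht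
  simp only [WordLayer.layerF, aeval_monoP, pow_succ]
  field_simp

/-- `t₂^{k+1} = t₂^k - t₂^k (1-t₂)` -/
theorem idSplitK (q : ℚ) (i j k β₀ β₁ γ₁ γ₂ α : ℕ) {t : Fin 3 → ℝ} (ht : t ∈ KZ.openOrderedSimplex 3) :
    WordLayer.layerF (monoP q i j (k + 1)) β₀ β₁ γ₁ (γ₂ + 1) α t =
      WordLayer.layerF (monoP q i j k) β₀ β₁ γ₁ (γ₂ + 1) α t + WordLayer.layerF (monoP (-q) i j k) β₀ β₁ γ₁ γ₂ α t := by
  obtain ⟨h0, h1, h1', h2', hd⟩ := WordLayer.simplex3_facts ht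
  simp only [WordLayer.layerF, aeval_monoP, pow_succ, Rat.cast_neg]
  field_simp
  ring

/-- `t₁^{j+1} = t₁^j - t₁^j (1-t₁)` -/
theorem idSplitJ (q : ℚ) (i j k β₀ β₁ γ₁ γ₂ α : ℕ) {t : Fin 3 → ℝ} (ht : t ∈ KZ.openOrderedSimplex 3) :
    WordLayer.layerF (monoP q i (j + 1) k) β₀ β₁ (γ₁ + 1) γ₂ α t =
      WordLayer.layerF (monoP q i j k) β₀ β₁ (γ₁ + 1) γ₂ α t + WordLayer.layerF (monoP (-q) i j k) β₀ β₁ γ₁ γ₂ α t := by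
  obtain ⟨h0, h1, h1', h2', hd⟩ := WordLayer.simplex3_facts ht
  simp only [WordLayer.layerF, aeval_monoP, pow_succ, Rat.cast_neg]
  field_simp
  ring

/-- `1/(t₁(1-t₁)) = 1/t₁ + 1/(1-t₁)` -/
theorem idSplitB (q : ℚ) (i j k β₀ β₁ γ₁ γ₂ α : ℕ) {t : Fin 3 → ℝ} (ht : t ∈ KZ.openOrderedSimplex 3) :
    WordLayer.layerF (monoP q i j k) β₀ (β₁ + 1) (γ₁ + 1) γ₂ α t =
      WordLayer.layerF (monoP q i j k) β₀ (β₁ + 1) γ₁ γ₂ α t + WordLayer.layerF (monoP q i j k) β₀ β₁ (γ₁ + 1) γ₂ α t := by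
  obtain ⟨h0, h1, h1', h2', hd⟩ := WordLayer.simplex3_facts ht
  simp only [WordLayer.layerF, aeval_monoP, pow_succ]
  field_simp
  ring

/-- diagonal identity `t₂^{k+1} = t₀ t₂^k - (t₀-t₂) t₂^k` (used with `α = 1`) -/
theorem idSplitDiagK (q : ℚ) (i j k β₀ β₁ γ₁ γ₂ : ℕ) {t : Fin 3 → ℝ} (ht : t ∈ KZ.openOrderedSimplex 3) :
    WordLayer.layerF (monoP q i j (k + 1)) (β₀ + 1) β₁ γ₁ γ₂ 1 t =
      WordLayer.layerF (monoP q i j k) β₀ β₁ γ₁ γ₂ 1 t + WordLayer.layerF (monoP (-q) i j k) (β₀ + 1) β₁ γ₁ γ₂ 0 t := by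
  obtain ⟨h0, h1, h1', h2', hd⟩ := WordLayer.simplex3_facts ht
  simp only [WordLayer.layerF, aeval_monoP, pow_succ, pow_zero, Rat.cast_neg]
  field_simp
  ring

/-- diagonal identity `t₀^{i+1} = t₀^i (t₀-t₂) + t₀^i t₂` (used with `α = 1`) -/
theorem idSplitDiagI (q : ℚ) (i j k β₀ β₁ γ₁ γ₂ : ℕ) {t : Fin 3 → ℝ} (ht : t ∈ KZ.openOrderedSimplex 3) :
    WordLayer.layerF (monoP q (i + 1) j k) β₀ β₁ γ₁ γ₂ 1 t =
      WordLayer.layerF (monoP q i j k) β₀ β₁ γ₁ γ₂ 0 t + WordLayer.layerF (monoP q i j (k + 1)) β₀ β₁ γ₁ γ₂ 1 t := by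
  obtain ⟨h0, h1, h1', h2', hd⟩ := WordLayer.simplex3_facts ht
  simp only [WordLayer.layerF, aeval_monoP, pow_succ, pow_zero]
  field_simp
  ring

/-- the dual of `q·1` is `q·1` -/
theorem idDualH (q : ℚ) (t : Fin 3 → ℝ) :
    WordLayer.layerF (WordLayer.duP3 (monoP q 0 0 0)) 0 1 0 1 1 t = WordLayer.layerF (monoP q 0 0 0) 0 1 0 1 1 t := by
  simp only [WordLayer.layerF, aeval_duP3_monoP, aeval_monoP, pow_zero, mul_one]

/-- Auxiliary step `idEform` (§47b): id Eform. [bookkeeping] -/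
theorem idEform (q : ℚ) (n : ℕ) (t : Fin 3 → ℝ) :
    WordLayer.layerF (monoP q 0 0 n) 0 1 0 0 1 t = (q : ℝ) * t 2 ^ n / (t 1 * (t 0 - t 2)) := by
  simp only [WordLayer.layerF, aeval_monoP, pow_zero, pow_one, one_mul, mul_one]

/-- Auxiliary step `idHform` (§47b): id Hform. [bookkeeping] -/
theorem idHform (q : ℚ) (t : Fin 3 → ℝ) :
    WordLayer.layerF (monoP q 0 0 0) 0 1 0 1 1 t = (q : ℝ) / (t 1 * (1 - t 2) * (t 0 - t 2)) := by
  simp only [WordLayer.layerF, aeval_monoP, pow_zero, pow_one, one_mul, mul_one]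

end ThreeLayer

end Summit.KontsevichZagierPeriods.KontsevichZagierPeriods.Cruxes.GZNormalFormWThree.GZLadder
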